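import Summits.ABC.IUTFork.Conditional.AbcOfSGenuineKWildInhabitedRow73Tame
import HarnessLib

/-!
# Branch C / R-W W1, inhabited side — OPEN-10.md row 7 (`73 + 2¹³·7⁷·941² = 3¹⁶·103³·127` at `l = 127`) with the TAME local types
# DISCHARGED: S_H inhabited modulo the 3-adic local type only (index `30·l = 3810` and a different bound) — part 2 of the rows 6/7 pair

PROOF-ONLY file (no `def`, no new `Prop`, no instance) of the abc-iut cell — D-0079 RESCUE sub-cell R-W «WINDOW Θ-SIDE INEQUALITY», W1 ROW
DECISIONS (D-0107), seat abc-iut-W-row-2 gen 0; part 2 (row 7, `l = 127`) of `AbcOfSGenuineKWildInhabitedRow73Tame` (row 6, `l = 73`); sequel of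
`AbcOfSGenuineKWildInhabitedRow73` (p476815). TAKES NO SIDE on [IUTchIII] Cor. 3.12 or on any author; «inhabited as typed» ≠ «asserted in print».

WHAT IS PROVED (namespace `Summit.ABC.IUTFork.Conditional`). **`GenuineK.exists_qPinned_and_hull_chosen_triple_73_l73_of_localType_three`**,
**`…_l127_…`** — for EVERY genuine Θ-volume datum `T` over `(ratPoint (73/c), l)`, `l = 73` resp. `127`, the CHOSEN realising ideles and every
choice of the free context binders / columns: IF every bad fibre point over `3` has `e(K_x/ℚ_3) = 30·l` (`2190` / `3810`; the tree proves
`30·l ∣ e`, abc-iut-W-neg-2) and `d(K_x) ≥ 1.7` resp. `1.4` (`hd3`; tabulated `≈ 2.0`), THEN branch C's per-datum antecedent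
«∃ ρ qK, QPinned ∧ PilotKummerCompatHull» HOLDS at `settingPrVolSharp (pilotDataOfK T.D T.K) …`. NO hypothesis at the TAME bad primes
(`7, 103, 127, 941` resp. `7, 73, 103, 941`): their index is READ OFF the datum (constant on the fibre, `WRow.absRamificationIdx_kOf_eq_of_finrank_eq_one`)
and pinned by the tree to `e ∣ 60·l` (abc-iut-W-neg-1), `l ∣ e`, `15·l ∣ e·v_p(abc)` (abc-iut-W-neg-2), i.e. `{15,30,60}·l` at `v_p(abc) ∈ {1, 2, 7}`
and `{5,10,15,20,30,60}·l` at `103` (`v = 3`); the cells hold at EACH value (this seat's row-6/7 margins table). Bridge: `Cor312LicenceWildInhabitedTripleBad`.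

HONEST SCOPE: OUR sharp containers and Dupuy–Hilado's typed (Ind1)/(Ind2); STRONGER-THAN-PRINT hull licence; NON-EMPTINESS of the datum type,
admissibility and Szpiro-badness NOT claimed; `he3`/`hd3` are HYPOTHESES; nothing about the printed GLOBAL inequality or the number-level corollary;
typed ≠ proved; instantiated ≠ endorsed. [cite: Mochizuki2012, IUTchI Def. 3.1 (b),(c) pp. 61–62, Rmk. 3.1.5 p. 65; IUTchIII Cor. 3.12 Step (xi-d)
p. 183, (xi-f) p. 184; IUTchIV Thm. 1.10 p. 22, Cor. 2.2 (ii) proof p. 44–46] [cite: DupuyHilado2025, §3.3, §3.4, §4.9, §4.12]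
[cite: SilvermanATAEC1994, V.5 Thm. 5.3] [claim: Mochizuki2012, status: disputed] for every IUT sentence quoted.
-/

noncomputable section

open Set Function NumberField IsDedekindDomain

namespace Summit.ABC.IUTFork.Conditional

open Thm311 Thm311.Real Cor312 Cor312Vol Cor312Prov Literature.IUT.LogThetaLattice Literature.IUT.LogVolume
  Literature.IUT.HodgeTheaters Literature.IUT.LogVolume.Cor22
open Literature.NumberTheory.NumberFields Literature.NumberTheory.GaloisRepresentations.Ultrametric
open Literature.NumberTheory.DiophantineGeometry Literature.NumberTheory.DiophantineGeometry.GenEll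

set_option maxRecDepth 16384 in
/-- **OPEN-10 ROW 7 — S_H INHABITED at `73 + 2¹³7⁷941² = 3¹⁶103³127`, `l = 127`, modulo the 3-adic local type only.** For every genuine
Θ-volume datum `T` at `(ratPoint (73/5973865915867209), 127)`, the CHOSEN realising ideles, every choice of the free context binders and columns: IF every
bad fibre point over `3` has `e(K_x/ℚ_3) = 3810 = 30·l` (`he3`) and `d(K_x) ≥ 5334/3810` (`hd3`), THEN «∃ ρ qK, QPinned ∧ PilotKummerCompatHull» at
`settingPrVolSharp (pilotDataOfK T.D T.K) …`. The indices over the tame bad primes `7, 73, 103, 941` are READ OFF the datum and pinned by the tree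
(`e ∣ 60·l`, `l ∣ e`, `15·l ∣ e·v_p(abc)`); every admissible value × `63` labels is decided.
[cite: Mochizuki2012, IUTchIII Cor. 3.12 Step (xi-d) p. 183, (xi-f) p. 184; IUTchIV Cor. 2.2 (ii) proof p. 44–46] [cite: DupuyHilado2025, §3.3, §3.4, §4.9]
[claim: Mochizuki2012, status: disputed] -/
theorem GenuineK.exists_qPinned_and_hull_chosen_triple_73_l127_of_localType_three
    (T : Cor22.ThetaVolumeDatumAt (ratPoint (((73 : ℕ) : ℚ) / (5973865915867209 : ℕ))) 127)
    (he3 : letI := T.instFieldF; letI := T.instNumberFieldF; letI := T.instAlgebraF; letI := T.instFieldK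
      letI := T.instNumberFieldK; letI := T.instAlgebraK; letI := T.instFieldFbar; letI := T.instAlgebraFbar
      letI := T.instAlgebraKFbar; letI := T.instIsElliptic
      ∀ (pp : Nat.Primes) (x : (thetaIndex (pilotDataOfK T.D T.K)).Fibre (.inr pp)), haveI : Fact (pp : ℕ).Prime := ⟨pp.2⟩
        (pp : ℕ) = 3 → placeOf (pilotDataOfK T.D T.K) pp.1 x ∈ (pilotDataOfK T.D T.K).S →
          absRamificationIdx (pp : ℕ) (kOf (pilotDataOfK T.D T.K) pp.1 x) = 3810)
    (hd3 : letI := T.instFieldF; letI := T.instNumberFieldF; letI := T.instAlgebraF; letI := T.instFieldK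
      letI := T.instNumberFieldK; letI := T.instAlgebraK; letI := T.instFieldFbar; letI := T.instAlgebraFbar
      letI := T.instAlgebraKFbar; letI := T.instIsElliptic
      ∀ (pp : Nat.Primes) (x : (thetaIndex (pilotDataOfK T.D T.K)).Fibre (.inr pp)), haveI : Fact (pp : ℕ).Prime := ⟨pp.2⟩
        (pp : ℕ) = 3 → placeOf (pilotDataOfK T.D T.K) pp.1 x ∈ (pilotDataOfK T.D T.K).S →
          ((5334 : ℕ) : ℝ) / ((3810 : ℕ) : ℝ) ≤ differentOrd (pp : ℕ) (kOf (pilotDataOfK T.D T.K) pp.1 x)) :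
    letI := T.instFieldF; letI := T.instNumberFieldF; letI := T.instAlgebraF; letI := T.instFieldK
    letI := T.instNumberFieldK; letI := T.instAlgebraK; letI := T.instFieldFbar; letI := T.instAlgebraFbar
    letI := T.instAlgebraKFbar; letI := T.instIsElliptic
    ∀ (M : Type) [Field M] [NumberField M]
      (archPk : ∀ (j : (thetaIndex (pilotDataOfK T.D T.K)).Label) (vQ : (thetaIndex (pilotDataOfK T.D T.K)).VQ),
        Set ((logShellsDH (pilotDataOfK T.D T.K) (analyticLogv T.K)).Packet j vQ))
      (archSub : ∀ (j : (thetaIndex (pilotDataOfK T.D T.K)).Label) (v : (thetaIndex (pilotDataOfK T.D T.K)).V),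
        Set ((logShellsDH (pilotDataOfK T.D T.K) (analyticLogv T.K)).Packet j ((thetaIndex (pilotDataOfK T.D T.K)).over v)))
      (Ψ : ℤ → ∀ v : (thetaIndex (pilotDataOfK T.D T.K)).V, v ∈ (thetaIndex (pilotDataOfK T.D T.K)).Vbad →
        Set ((logShellsDH (pilotDataOfK T.D T.K) (analyticLogv T.K)).StarPacket v))
      (act : ℤ → ∀ v : (thetaIndex (pilotDataOfK T.D T.K)).V, v ∈ (thetaIndex (pilotDataOfK T.D T.K)).Vbad →
        (logShellsDH (pilotDataOfK T.D T.K) (analyticLogv T.K)).StarPacket v →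
          Module.End ℚ ((logShellsDH (pilotDataOfK T.D T.K) (analyticLogv T.K)).StarPacket v))
      (Mmod : ℤ → ∀ j : (thetaIndex (pilotDataOfK T.D T.K)).LabelStar,
        Set ((logShellsDH (pilotDataOfK T.D T.K) (analyticLogv T.K)).GlobalPacket j.1))
      (region : ℤ → ∀ j : (thetaIndex (pilotDataOfK T.D T.K)).LabelStar, FinDivisor M → ∀ vQ : (thetaIndex (pilotDataOfK T.D T.K)).VQ,
        Set ((logShellsDH (pilotDataOfK T.D T.K) (analyticLogv T.K)).Packet j.1 vQ))
      (n : ℤ) {HT : Type} {LogLink : HT → HT → Type} {IsFull : ∀ {s t : HT}, LogLink s t → Prop}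
      (lat : LGPGaussianLogThetaLattice LogLink IsFull)
      {Frd : Type} {IsoF : Frd → Frd → Type} {Ob : Frd → Type} {realify : Frd → Frd} {Strip : Type}
      {IsoS : Strip → Strip → Type} {Mv : ∀ v : (thetaIndex (pilotDataOfK T.D T.K)).V, v ∈ (thetaIndex (pilotDataOfK T.D T.K)).Vbad → Type}
      [∀ v h, Monoid (Mv v h)]
      (sig : GlobalLGPFrobenioidSignature (thetaIndex (pilotDataOfK T.D T.K)).lstar (thetaIndex (pilotDataOfK T.D T.K)).V
        (· ∈ (thetaIndex (pilotDataOfK T.D T.K)).Vbad) Frd IsoF Ob realify Strip IsoS Mv)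
      (split : SplittingMonoids Mv) {ObΔ : Type}
      {N : ∀ v : (thetaIndex (pilotDataOfK T.D T.K)).V, v ∈ (thetaIndex (pilotDataOfK T.D T.K)).Vbad → Type}
      [∀ v h, Monoid (N v h)] (qData : QPilotData ObΔ N)
      (col : ℤ → Column (logShellsDH (pilotDataOfK T.D T.K) (analyticLogv T.K))),
      ∃ (ρ' : (∀ v : (thetaIndex (pilotDataOfK T.D T.K)).V, v ∈ (thetaIndex (pilotDataOfK T.D T.K)).Vbad →
            Set ((logShellsDH (pilotDataOfK T.D T.K) (analyticLogv T.K)).StarPacket v)) →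
          ∀ (j : (thetaIndex (pilotDataOfK T.D T.K)).Label) (vQ : (thetaIndex (pilotDataOfK T.D T.K)).VQ),
            Set ((logShellsDH (pilotDataOfK T.D T.K) (analyticLogv T.K)).Packet j vQ))
        (qK : ∀ v : (thetaIndex (pilotDataOfK T.D T.K)).V, v ∈ (thetaIndex (pilotDataOfK T.D T.K)).Vbad →
          Set ((logShellsDH (pilotDataOfK T.D T.K) (analyticLogv T.K)).StarPacket v)),
        QPinned ({ toSituation := (situationPrVol (pilotDataOfK T.D T.K) (logvAnalytic_analyticLogv (F := T.K)) M archPk archSub Ψ act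
              Mmod region), col := col } : LatticeSituation (thetaIndex (pilotDataOfK T.D T.K)))
          (settingPrVolSharp (pilotDataOfK T.D T.K) (logvAnalytic_analyticLogv (F := T.K)) M archPk archSub Ψ act Mmod region n lat
            sig split qData (exists_realising_qIdeles_pilotDataOfK T.D).choose (exists_realising_thetaIdeles_pilotDataOfK T.D).choose
            (exists_realising_qIdeles_pilotDataOfK T.D).choose_spec.1 (exists_realising_qIdeles_pilotDataOfK T.D).choose_spec.2.1) ρ' qK ∧
        PilotKummerCompatHull ({ toSituation := (situationPrVol (pilotDataOfK T.D T.K) (logvAnalytic_analyticLogv (F := T.K)) M archPk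
              archSub Ψ act Mmod region), col := col } : LatticeSituation (thetaIndex (pilotDataOfK T.D T.K)))
          (settingPrVolSharp (pilotDataOfK T.D T.K) (logvAnalytic_analyticLogv (F := T.K)) M archPk archSub Ψ act Mmod region n lat
            sig split qData (exists_realising_qIdeles_pilotDataOfK T.D).choose (exists_realising_thetaIdeles_pilotDataOfK T.D).choose
            (exists_realising_qIdeles_pilotDataOfK T.D).choose_spec.1 (exists_realising_qIdeles_pilotDataOfK T.D).choose_spec.2.1) ρ' qK := by
  classical
  letI := T.instFieldF; letI := T.instNumberFieldF; letI := T.instAlgebraF; letI := T.instFieldK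
  letI := T.instNumberFieldK; letI := T.instAlgebraK; letI := T.instFieldFbar; letI := T.instAlgebraFbar
  letI := T.instAlgebraKFbar; letI := T.instIsElliptic
  intro M _ _ archPk archSub Ψ act Mmod region n HT LogLink IsFull lat Frd IsoF Ob realify Strip IsoS Mv _ sig split ObΔ N _ qData col
  have hF : Module.finrank ℚ (fieldOfModuli T.E) = 1 :=
    T.finrank_rat_fieldOfModuli_eq_dmod.trans (dmod_eq_one_of_degree_le_one (by rw [degree_ratPoint]))
  have hj : T.E.j = ((Cor22.jInv (((73 : ℕ) : ℚ) / (5973865915867209 : ℕ)) : ℚ) : T.F) := by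
    rw [T.j_eq]; exact eq_ratCast _ _
  have hl : (pilotDataOfK T.D T.K).lstar = 63 := by simp only [PilotData.lstar, pilotDataOfK_l]
  obtain ⟨hf3, hf7, hf73, hf103, -, hf941⟩ := factorization_triple_73
  -- the per-prime index: BY NAME over `3`, READ OFF THE DATUM elsewhere
  set eT : Nat.Primes → ℕ := fun pp =>
    haveI : Fact (pp : ℕ).Prime := ⟨pp.2⟩
    if (pp : ℕ) = 3 then 3810 else
      if h : ∃ x : (thetaIndex (pilotDataOfK T.D T.K)).Fibre (.inr pp), placeOf (pilotDataOfK T.D T.K) pp.1 x ∈ (pilotDataOfK T.D T.K).S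
      then absRamificationIdx (pp : ℕ) (kOf (pilotDataOfK T.D T.K) pp.1 h.choose) else 1 with heT
  have hpole : ∀ (pp : Nat.Primes), (pp : ℕ) ∣ 73 * 5973865915867136 * 5973865915867209 → (pp : ℕ) ≠ 2 →
      ∀ v : HeightOneSpectrum (𝓞 ℚ), Rat.HeightOneSpectrum.natGenerator v = pp →
        ord ℚ v (Cor22.jInv (((73 : ℕ) : ℚ) / (5973865915867209 : ℕ))) =
          -(2 * (((73 * 5973865915867136 * 5973865915867209).factorization pp : ℕ) : ℤ)) := fun pp hdvd h2 v hv =>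
    (Cor22.ord_jInv_ratPoint_triple_eq isABCTriple_frey73 v (by rw [hv]; exact h2) (by rw [hv]; exact hdvd)).trans (by rw [hv])
  refine exists_qPinned_and_hull_settingPrVolSharp_pilotDataOfK_triple_of_bad T.D (logvAnalytic_analyticLogv (F := T.K)) M archPk
    archSub Ψ act Mmod region n lat sig split qData (exists_realising_qIdeles_pilotDataOfK T.D).choose
    (exists_realising_thetaIdeles_pilotDataOfK T.D).choose (exists_realising_qIdeles_pilotDataOfK T.D).choose_spec.1
    (exists_realising_qIdeles_pilotDataOfK T.D).choose_spec.2.1 col (exists_realising_thetaIdeles_pilotDataOfK T.D).choose_spec.1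
    (exists_realising_thetaIdeles_pilotDataOfK T.D).choose_spec.2.2 (exists_realising_qIdeles_pilotDataOfK T.D).choose_spec.2.2
    isABCTriple_frey73 hj hF eT (fun pp => if (pp : ℕ) = 3 then 5334 else eT pp - 1)
    (fun pp => if (pp : ℕ) = 3 then 7 else if (pp : ℕ) = 7 then (if eT pp ≤ 2058 then 3 else 4) else
      if (pp : ℕ) = 73 then (if eT pp ≤ 5256 then 1 else 2) else 1)
    (fun pp x hx => ?_) (fun pp hdvd h2 hl' hbad => ?_)
  · -- the local inputs
    haveI : Fact (pp : ℕ).Prime := ⟨pp.2⟩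
    by_cases h3 : (pp : ℕ) = 3
    · have hv : eT pp = 3810 := by simp only [heT, h3, if_true]
      refine ⟨by rw [hv]; exact he3 pp x h3 hx, ?_⟩
      have h := hd3 pp x h3 hx
      simp only [h3, if_true, hv]
      exact h
    · have hex : ∃ y : (thetaIndex (pilotDataOfK T.D T.K)).Fibre (.inr pp),
          placeOf (pilotDataOfK T.D T.K) pp.1 y ∈ (pilotDataOfK T.D T.K).S := ⟨x, hx⟩
      have hv : eT pp = absRamificationIdx (pp : ℕ) (kOf (pilotDataOfK T.D T.K) pp.1 hex.choose) := by
        simp only [heT, h3, if_false, dif_pos hex]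
      have he : absRamificationIdx (pp : ℕ) (kOf (pilotDataOfK T.D T.K) pp.1 x) = eT pp := by
        rw [hv]; exact WRow.absRamificationIdx_kOf_eq_of_finrank_eq_one T.D hF pp x hex.choose
      refine ⟨he, ?_⟩
      have h := pred_div_le_differentOrd_of_eq (pp : ℕ) he
      simp only [h3, if_false] at h ⊢
      exact h
  · -- the arithmetic at the bad primes; over the tame ones for every index the tree allows
    haveI : Fact (pp : ℕ).Prime := ⟨pp.2⟩
    rw [hl]
    rcases eq_of_prime_dvd_triple_73 pp.2 hdvd with h | h | h | h | h | h | h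
    · exact absurd h h2
    · have hv : eT pp = 3810 := by simp only [heT, h, if_true]
      simp only [hv, h, hf3, if_true, Nat.reduceEqDiff]; decide
    · -- `p = 7`: the index read off the datum, pinned by `e ∣ 60·l`, `l ∣ e`, `15·l ∣ e·7`
      have hv : eT pp = absRamificationIdx (pp : ℕ) (kOf (pilotDataOfK T.D T.K) pp.1 hbad.choose) := by
        simp only [heT, h, Nat.reduceEqDiff, if_false, dif_pos hbad]
      have hneg : ∀ v : HeightOneSpectrum (𝓞 ℚ), Rat.HeightOneSpectrum.natGenerator v = pp →
          ord ℚ v (Cor22.jInv (((73 : ℕ) : ℚ) / (5973865915867209 : ℕ))) < 0 := fun v hv => by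
        rw [hpole pp hdvd h2 v hv, h, hf7]; norm_num
      have ht : ∀ v : HeightOneSpectrum (𝓞 ℚ), Rat.HeightOneSpectrum.natGenerator v = pp →
          ord ℚ v (Cor22.jInv (((73 : ℕ) : ℚ) / (5973865915867209 : ℕ))) = -(2 * ((7 : ℕ) : ℤ)) := fun v hv => by
        rw [hpole pp hdvd h2 v hv, h, hf7]
      obtain ⟨hU, -⟩ := GenuineK.absRamificationIdx_kOf_dvd_ratPoint T pp h2 (by rw [h]; norm_num) (by rw [h]; norm_num) hl' hneg hbad.choose
      have hL1 := GenuineK.prime_dvd_absRamificationIdx_kOf_ratPoint T pp h2 hl' hneg hbad.choose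
      have hL2 := GenuineK.fifteen_mul_prime_dvd_absRamificationIdx_kOf_mul_ratPoint T pp h2 hl' (t := 7) (by norm_num) ht hbad.choose
      rw [← hv] at hU hL1 hL2
      obtain ⟨d, hd⟩ := hL1
      have hd60 : d ∣ 60 := Nat.dvd_of_mul_dvd_mul_left (by norm_num : 0 < 127) (by rw [← hd]; simpa [mul_comm] using hU)
      have hd15 : 15 ∣ d * 7 := Nat.dvd_of_mul_dvd_mul_left (by norm_num : 0 < 127)
        (by have := hL2; rw [hd] at this; simpa [mul_comm, mul_assoc, mul_left_comm] using this)
      rcases eq_of_dvd_sixty_of_fifteen_dvd_mul_coprime (t := 7) (by norm_num) hd60 hd15 with rfl | rfl | rfl <;>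
        simp only [hd, h, hf7, if_true, if_false, Nat.reduceEqDiff] <;> decide
    · -- `p = 73`: the index read off the datum, pinned by `e ∣ 60·l`, `l ∣ e`, `15·l ∣ e·1`
      have hv : eT pp = absRamificationIdx (pp : ℕ) (kOf (pilotDataOfK T.D T.K) pp.1 hbad.choose) := by
        simp only [heT, h, Nat.reduceEqDiff, if_false, dif_pos hbad]
      have hneg : ∀ v : HeightOneSpectrum (𝓞 ℚ), Rat.HeightOneSpectrum.natGenerator v = pp →
          ord ℚ v (Cor22.jInv (((73 : ℕ) : ℚ) / (5973865915867209 : ℕ))) < 0 := fun v hv => by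
        rw [hpole pp hdvd h2 v hv, h, hf73]; norm_num
      have ht : ∀ v : HeightOneSpectrum (𝓞 ℚ), Rat.HeightOneSpectrum.natGenerator v = pp →
          ord ℚ v (Cor22.jInv (((73 : ℕ) : ℚ) / (5973865915867209 : ℕ))) = -(2 * ((1 : ℕ) : ℤ)) := fun v hv => by
        rw [hpole pp hdvd h2 v hv, h, hf73]
      obtain ⟨hU, -⟩ := GenuineK.absRamificationIdx_kOf_dvd_ratPoint T pp h2 (by rw [h]; norm_num) (by rw [h]; norm_num) hl' hneg hbad.choose
      have hL1 := GenuineK.prime_dvd_absRamificationIdx_kOf_ratPoint T pp h2 hl' hneg hbad.choose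
      have hL2 := GenuineK.fifteen_mul_prime_dvd_absRamificationIdx_kOf_mul_ratPoint T pp h2 hl' (t := 1) (by norm_num) ht hbad.choose
      rw [← hv] at hU hL1 hL2
      obtain ⟨d, hd⟩ := hL1
      have hd60 : d ∣ 60 := Nat.dvd_of_mul_dvd_mul_left (by norm_num : 0 < 127) (by rw [← hd]; simpa [mul_comm] using hU)
      have hd15 : 15 ∣ d * 1 := Nat.dvd_of_mul_dvd_mul_left (by norm_num : 0 < 127)
        (by have := hL2; rw [hd] at this; simpa [mul_comm, mul_assoc, mul_left_comm] using this)
      rcases eq_of_dvd_sixty_of_fifteen_dvd_mul_coprime (t := 1) (by norm_num) hd60 hd15 with rfl | rfl | rfl <;>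
        simp only [hd, h, hf73, if_true, if_false, Nat.reduceEqDiff] <;> decide
    · -- `p = 103`: the index read off the datum, pinned by `e ∣ 60·l`, `l ∣ e`, `15·l ∣ e·3`
      have hv : eT pp = absRamificationIdx (pp : ℕ) (kOf (pilotDataOfK T.D T.K) pp.1 hbad.choose) := by
        simp only [heT, h, Nat.reduceEqDiff, if_false, dif_pos hbad]
      have hneg : ∀ v : HeightOneSpectrum (𝓞 ℚ), Rat.HeightOneSpectrum.natGenerator v = pp →
          ord ℚ v (Cor22.jInv (((73 : ℕ) : ℚ) / (5973865915867209 : ℕ))) < 0 := fun v hv => by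
        rw [hpole pp hdvd h2 v hv, h, hf103]; norm_num
      have ht : ∀ v : HeightOneSpectrum (𝓞 ℚ), Rat.HeightOneSpectrum.natGenerator v = pp →
          ord ℚ v (Cor22.jInv (((73 : ℕ) : ℚ) / (5973865915867209 : ℕ))) = -(2 * ((3 : ℕ) : ℤ)) := fun v hv => by
        rw [hpole pp hdvd h2 v hv, h, hf103]
      obtain ⟨hU, -⟩ := GenuineK.absRamificationIdx_kOf_dvd_ratPoint T pp h2 (by rw [h]; norm_num) (by rw [h]; norm_num) hl' hneg hbad.choose
      have hL1 := GenuineK.prime_dvd_absRamificationIdx_kOf_ratPoint T pp h2 hl' hneg hbad.choose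
      have hL2 := GenuineK.fifteen_mul_prime_dvd_absRamificationIdx_kOf_mul_ratPoint T pp h2 hl' (t := 3) (by norm_num) ht hbad.choose
      rw [← hv] at hU hL1 hL2
      obtain ⟨d, hd⟩ := hL1
      have hd60 : d ∣ 60 := Nat.dvd_of_mul_dvd_mul_left (by norm_num : 0 < 127) (by rw [← hd]; simpa [mul_comm] using hU)
      have hd15 : 15 ∣ d * 3 := Nat.dvd_of_mul_dvd_mul_left (by norm_num : 0 < 127)
        (by have := hL2; rw [hd] at this; simpa [mul_comm, mul_assoc, mul_left_comm] using this)
      rcases eq_of_dvd_sixty_of_five_dvd hd60 (by omega) with rfl | rfl | rfl | rfl | rfl | rfl <;>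
        simp only [hd, h, hf103, if_false, Nat.reduceEqDiff] <;> decide
    · exact absurd h hl'
    · -- `p = 941`: the index read off the datum, pinned by `e ∣ 60·l`, `l ∣ e`, `15·l ∣ e·2`
      have hv : eT pp = absRamificationIdx (pp : ℕ) (kOf (pilotDataOfK T.D T.K) pp.1 hbad.choose) := by
        simp only [heT, h, Nat.reduceEqDiff, if_false, dif_pos hbad]
      have hneg : ∀ v : HeightOneSpectrum (𝓞 ℚ), Rat.HeightOneSpectrum.natGenerator v = pp →
          ord ℚ v (Cor22.jInv (((73 : ℕ) : ℚ) / (5973865915867209 : ℕ))) < 0 := fun v hv => by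
        rw [hpole pp hdvd h2 v hv, h, hf941]; norm_num
      have ht : ∀ v : HeightOneSpectrum (𝓞 ℚ), Rat.HeightOneSpectrum.natGenerator v = pp →
          ord ℚ v (Cor22.jInv (((73 : ℕ) : ℚ) / (5973865915867209 : ℕ))) = -(2 * ((2 : ℕ) : ℤ)) := fun v hv => by
        rw [hpole pp hdvd h2 v hv, h, hf941]
      obtain ⟨hU, -⟩ := GenuineK.absRamificationIdx_kOf_dvd_ratPoint T pp h2 (by rw [h]; norm_num) (by rw [h]; norm_num) hl' hneg hbad.choose
      have hL1 := GenuineK.prime_dvd_absRamificationIdx_kOf_ratPoint T pp h2 hl' hneg hbad.choose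
      have hL2 := GenuineK.fifteen_mul_prime_dvd_absRamificationIdx_kOf_mul_ratPoint T pp h2 hl' (t := 2) (by norm_num) ht hbad.choose
      rw [← hv] at hU hL1 hL2
      obtain ⟨d, hd⟩ := hL1
      have hd60 : d ∣ 60 := Nat.dvd_of_mul_dvd_mul_left (by norm_num : 0 < 127) (by rw [← hd]; simpa [mul_comm] using hU)
      have hd15 : 15 ∣ d * 2 := Nat.dvd_of_mul_dvd_mul_left (by norm_num : 0 < 127)
        (by have := hL2; rw [hd] at this; simpa [mul_comm, mul_assoc, mul_left_comm] using this)
      rcases eq_of_dvd_sixty_of_fifteen_dvd_mul_coprime (t := 2) (by norm_num) hd60 hd15 with rfl | rfl | rfl <;>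
        simp only [hd, h, hf941, if_false, Nat.reduceEqDiff] <;> decide

end Summit.ABC.IUTFork.Conditional

end
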